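/-
Copyright (c) 2026 The H21 project. Released under Apache 2.0 license.
-/
import Summits.RiemannHypothesis.RiemannHypothesis.Theorems.PfPersistenceGalerkinNegIndexForms
import Summits.RiemannHypothesis.RiemannHypothesis.Theorems.PfPersistenceGalerkinTestDensity
import HarnessLib

/-!
# `P_F` persistence — GAL-3 preparation: limits of finite-dimensional forms; the LINEAR Fejér–Galerkin
# approximant along the whole ladder (cand-3, gen 10)

Mechanism / rigidity campaign of the `pub-rhpf` cell (variational seat M2 = cand-3); NO claim about RH is made
anywhere in this file.  Everything here is RH-free and sorry-free; no numerical datum is used (all PROVED).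

Three self-contained inputs of the transfer `EvenNegIndexAtLeast n a ⇒ ∃ N, GalerkinNegIndexAtLeast ζ n (a, N)`
(`PfPersistenceGalerkinNegIndex`):
* §1 `eventually_negDef_of_tendsto` — on `ℝⁿ`, if the quadratic forms of matrices `B_k` converge POINTWISE to a
  function that is `< 0` off the origin, then `B_k` is negative definite for all large `k` (polarisation: the
  symmetrised entries converge; the limit is the quadratic form of the limit entries; compactness of the unit
  sphere gives a margin `-δ|c|²`; entrywise `η`-closeness costs `≤ n²η|c|²`).
* §2 LINEARITY: the Fejér coefficient vector `fejerVec` of GAL-1 is linear in the (real part of the) test, and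
  cut-off profiles are linear in the coefficient vector; hence the level-`M` FEJÉR–GALERKIN VECTOR
  `fejerGalerkinVec a g M` of a combination `∑ cᵢ gᵢ` is `∑ cᵢ • fejerGalerkinVec a gᵢ M`.
* §3 `fejerGalerkin_approx` — GAL-1's estimate along the WHOLE Fejér ladder: one Lipschitz constant for
  `θ_M - g` at every level `M`, and `‖θ_M - g‖_∞ ≤ ε` for ALL large `M` (refines `exists_cutoffProfile_near`,
  which produced one level).
-/

set_option linter.dupNamespace false

noncomputable section

open Set Matrix Finset Filter MeasureTheory
open scoped Topology

namespace Summit.RiemannHypothesis.RiemannHypothesis.Theorems.PfPersistence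

open Literature.NumberTheory.LFunctions
open FejerProfile TestDensity Real

/-! ## §1 Finite dimension: pointwise limits of quadratic forms with a negative-definite limit -/

/-- the symmetrised POLARISATION COEFFICIENT of a function on `ℝⁿ` at the coordinate pair `(i, j)`. [folklore] -/
def polarCoeff {n : ℕ} (F : (Fin n → ℝ) → ℝ) (i j : Fin n) : ℝ :=
  (F (Pi.single i 1 + Pi.single j 1) - F (Pi.single i 1) - F (Pi.single j 1)) / 2

/-- PROVED: the polarisation coefficients of a quadratic form are the symmetrised entries. [folklore] -/
theorem polarCoeff_form {n : ℕ} (B : Matrix (Fin n) (Fin n) ℝ) (i j : Fin n) :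
    polarCoeff (fun x ↦ x ⬝ᵥ (B *ᵥ x)) i j = (B i j + B j i) / 2 := by
  simp only [polarCoeff, Matrix.mulVec_add, add_dotProduct, dotProduct_add, single_form_single]
  ring

/-- PROVED: a quadratic form is recovered from its polarisation coefficients. [folklore] -/
theorem form_eq_sum_polarCoeff {n : ℕ} (B : Matrix (Fin n) (Fin n) ℝ) (c : Fin n → ℝ) :
    c ⬝ᵥ (B *ᵥ c) = ∑ i, ∑ j, c i * c j * polarCoeff (fun x ↦ x ⬝ᵥ (B *ᵥ x)) i j := by
  rw [form_eq_sum_sum]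
  have hsymm : ∑ i, ∑ j, c i * c j * B j i = ∑ i, ∑ j, c i * c j * B i j :=
    Finset.sum_comm.trans (sum_congr rfl fun i _ ↦ sum_congr rfl fun j _ ↦ by ring)
  have hsplit : ∀ i j, c i * c j * polarCoeff (fun x ↦ x ⬝ᵥ (B *ᵥ x)) i j =
      c i * c j * B i j / 2 + c i * c j * B j i / 2 := fun i j ↦ by rw [polarCoeff_form]; ring
  simp_rw [hsplit, sum_add_distrib, ← sum_div, hsymm]
  ring

/-- **PROVED — FINITE-DIMENSIONAL STABILITY OF NEGATIVE DEFINITENESS UNDER POINTWISE LIMITS.**  If the quadratic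
forms `c ↦ cᵀ B_k c` on `ℝⁿ` converge POINTWISE to a function `G` with `G(c) < 0` for every `c ≠ 0`, then for all
large `k` the form of `B_k` is negative definite.  (Polarisation makes the symmetrised entries converge; `G` is then
itself the quadratic form of the limit entries, gets a margin `-δ|c|²` on the compact unit sphere, and entrywise
`η`-closeness costs at most `n² η |c|²`.) [folklore] -/
theorem eventually_negDef_of_tendsto {n : ℕ} (B : ℕ → Matrix (Fin n) (Fin n) ℝ) (G : (Fin n → ℝ) → ℝ)
    (hconv : ∀ c, Tendsto (fun k ↦ c ⬝ᵥ (B k *ᵥ c)) atTop (𝓝 (G c))) (hneg : ∀ c, c ≠ 0 → G c < 0) :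
    ∃ k₀ : ℕ, ∀ k, k₀ ≤ k → ∀ c : Fin n → ℝ, c ≠ 0 → c ⬝ᵥ (B k *ᵥ c) < 0 := by
  -- the symmetrised entries converge to the polarisation coefficients `P` of `G`
  set P : Fin n → Fin n → ℝ := polarCoeff G with hPdef
  have hP : ∀ i j, Tendsto (fun k ↦ polarCoeff (fun x ↦ x ⬝ᵥ (B k *ᵥ x)) i j) atTop (𝓝 (P i j)) :=
    fun i j ↦ by
      simp only [hPdef, polarCoeff]
      exact (((hconv _).sub (hconv _)).sub (hconv _)).div_const 2
  -- hence `G` is the quadratic form `Q` of `P`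
  set Q : (Fin n → ℝ) → ℝ := fun c ↦ ∑ i, ∑ j, c i * c j * P i j with hQdef
  have hGQ : ∀ c, G c = Q c := fun c ↦ by
    have h2 : Tendsto (fun k ↦ ∑ i, ∑ j, c i * c j * polarCoeff (fun x ↦ x ⬝ᵥ (B k *ᵥ x)) i j) atTop
        (𝓝 (Q c)) :=
      tendsto_finsetSum _ fun i _ ↦ tendsto_finsetSum _ fun j _ ↦ (hP i j).const_mul _
    exact tendsto_nhds_unique (hconv c) (h2.congr fun k ↦ (form_eq_sum_polarCoeff (B k) c).symm)
  have hQsmul : ∀ (t : ℝ) (c : Fin n → ℝ), Q (t • c) = t * t * Q c := fun t c ↦ by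
    simp only [hQdef, Pi.smul_apply, smul_eq_mul, Finset.mul_sum]
    exact sum_congr rfl fun i _ ↦ sum_congr rfl fun j _ ↦ by ring
  have hQc : Continuous Q := continuous_finsetSum _ fun i _ ↦ continuous_finsetSum _ fun j _ ↦
    ((continuous_apply i).mul (continuous_apply j)).mul continuous_const
  -- single coordinates are bounded by the self dot product
  have hcoord : ∀ (c : Fin n → ℝ) (i : Fin n), c i * c i ≤ c ⬝ᵥ c := fun c i ↦ by
    unfold dotProduct
    exact Finset.single_le_sum (f := fun l ↦ c l * c l) (fun l _ ↦ mul_self_nonneg (c l)) (mem_univ i)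
  -- a margin on the unit sphere
  set S : Set (Fin n → ℝ) := {c | c ⬝ᵥ c = 1} with hSdef
  have hScpt : IsCompact S := by
    refine Metric.isCompact_of_isClosed_isBounded ?_ ?_
    · exact isClosed_eq (continuous_finsetSum _ fun i _ ↦ (continuous_apply i).mul (continuous_apply i))
        continuous_const
    · refine (Metric.isBounded_closedBall (x := (0 : Fin n → ℝ)) (r := 1)).subset fun c hc ↦ ?_
      rw [Metric.mem_closedBall, dist_zero_right, pi_norm_le_iff_of_nonneg zero_le_one]
      intro i
      rw [Real.norm_eq_abs, ← sq_le_one_iff_abs_le_one, sq]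
      exact (hcoord c i).trans_eq hc
  have hnormalise : ∀ c : Fin n → ℝ, c ≠ 0 → ∃ r : ℝ, 0 < r ∧ r * r = c ⬝ᵥ c ∧ r⁻¹ • c ∈ S := by
    intro c hc
    have hr : 0 < c ⬝ᵥ c := dotSelf_pos_of_ne_zero hc
    refine ⟨Real.sqrt (c ⬝ᵥ c), Real.sqrt_pos.2 hr, Real.mul_self_sqrt hr.le, ?_⟩
    show (Real.sqrt (c ⬝ᵥ c))⁻¹ • c ⬝ᵥ (Real.sqrt (c ⬝ᵥ c))⁻¹ • c = 1
    rw [smul_dotProduct, dotProduct_smul, smul_eq_mul, smul_eq_mul, ← mul_assoc, ← mul_inv,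
      Real.mul_self_sqrt hr.le, inv_mul_cancel₀ hr.ne']
  have hmargin : ∃ δ : ℝ, 0 < δ ∧ ∀ c : Fin n → ℝ, c ≠ 0 → Q c ≤ -δ * (c ⬝ᵥ c) := by
    by_cases hSne : S.Nonempty
    · obtain ⟨c₀, hc₀S, hmax⟩ := hScpt.exists_isMaxOn hSne hQc.continuousOn
      have hc₀0 : c₀ ≠ 0 := by
        rintro rfl
        have : (0 : Fin n → ℝ) ⬝ᵥ 0 = 1 := hc₀S
        simp at this
      have hQ₀ : Q c₀ < 0 := by rw [← hGQ]; exact hneg c₀ hc₀0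
      refine ⟨-Q c₀, neg_pos.2 hQ₀, fun c hc ↦ ?_⟩
      obtain ⟨r, hr0, hrr, hcS⟩ := hnormalise c hc
      have h1 : Q (r⁻¹ • c) ≤ Q c₀ := hmax hcS
      have h2 : Q c = r * r * Q (r⁻¹ • c) := by
        rw [hQsmul]; field_simp
      rw [h2, ← hrr]
      nlinarith [mul_le_mul_of_nonneg_left h1 (mul_self_nonneg r)]
    · refine ⟨1, one_pos, fun c hc ↦ ?_⟩
      obtain ⟨r, -, -, hcS⟩ := hnormalise c hc
      exact absurd ⟨_, hcS⟩ hSne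
  obtain ⟨δ, hδ, hQδ⟩ := hmargin
  -- entrywise closeness, uniformly in the finitely many coordinate pairs
  set η : ℝ := δ / (2 * ((n : ℝ) ^ 2 + 1)) with hηdef
  have hη : 0 < η := by positivity
  have hηn : (n : ℝ) ^ 2 * η ≤ δ / 2 := by
    rw [hηdef, mul_div_assoc', div_le_div_iff₀ (by positivity) (by positivity)]
    nlinarith [hδ, sq_nonneg (n : ℝ)]
  have hev : ∀ᶠ k in atTop, ∀ i j, |polarCoeff (fun x ↦ x ⬝ᵥ (B k *ᵥ x)) i j - P i j| < η :=
    eventually_all.2 fun i ↦ eventually_all.2 fun j ↦ by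
      simpa only [Real.dist_eq] using Metric.tendsto_nhds.1 (hP i j) η hη
  obtain ⟨k₀, hk₀⟩ := eventually_atTop.1 hev
  refine ⟨k₀, fun k hk c hc ↦ ?_⟩
  have hPk := hk₀ k hk
  have hcc : 0 < c ⬝ᵥ c := dotSelf_pos_of_ne_zero hc
  rw [form_eq_sum_polarCoeff]
  have hsplit : ∑ i, ∑ j, c i * c j * polarCoeff (fun x ↦ x ⬝ᵥ (B k *ᵥ x)) i j =
      Q c + ∑ i, ∑ j, c i * c j * (polarCoeff (fun x ↦ x ⬝ᵥ (B k *ᵥ x)) i j - P i j) := by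
    simp only [hQdef, ← sum_add_distrib]
    exact sum_congr rfl fun i _ ↦ sum_congr rfl fun j _ ↦ by ring
  have hbound : ∑ i, ∑ j, c i * c j * (polarCoeff (fun x ↦ x ⬝ᵥ (B k *ᵥ x)) i j - P i j) ≤
      ∑ _i : Fin n, ∑ _j : Fin n, (c ⬝ᵥ c) * η := by
    refine sum_le_sum fun i _ ↦ sum_le_sum fun j _ ↦ ?_
    have hij : |c i * c j| ≤ c ⬝ᵥ c := by
      rw [abs_mul]
      nlinarith [two_mul_le_add_sq |c i| |c j|, abs_mul_abs_self (c i), abs_mul_abs_self (c j),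
        hcoord c i, hcoord c j, abs_nonneg (c i), abs_nonneg (c j)]
    calc c i * c j * (polarCoeff (fun x ↦ x ⬝ᵥ (B k *ᵥ x)) i j - P i j)
        ≤ |c i * c j * (polarCoeff (fun x ↦ x ⬝ᵥ (B k *ᵥ x)) i j - P i j)| := le_abs_self _
      _ = |c i * c j| * |polarCoeff (fun x ↦ x ⬝ᵥ (B k *ᵥ x)) i j - P i j| := abs_mul _ _
      _ ≤ (c ⬝ᵥ c) * η := mul_le_mul hij (hPk i j).le (abs_nonneg _) hcc.le
  have hsum : ∑ _i : Fin n, ∑ _j : Fin n, (c ⬝ᵥ c) * η = (n : ℝ) ^ 2 * η * (c ⬝ᵥ c) := by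
    simp only [sum_const, card_univ, Fintype.card_fin, nsmul_eq_mul]
    ring
  rw [hsplit]
  nlinarith [hQδ c hc, hbound, hsum, mul_le_mul_of_nonneg_right hηn hcc.le]

/-! ## §2 Linearity of the Fejér–Galerkin approximant of GAL-1 -/

/-- PROVED: cosine moments are linear over finite real combinations of continuous functions. [folklore] -/
theorem cosMoment_sum_mul {n : ℕ} (a : ℝ) (c : Fin n → ℝ) (gr : Fin n → ℝ → ℝ) (hgr : ∀ i, Continuous (gr i))
    (m : ℕ) : cosMoment a (fun x ↦ ∑ i, c i * gr i x) m = ∑ i, c i * cosMoment a (gr i) m := by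
  simp only [cosMoment, Finset.sum_mul]
  rw [intervalIntegral.integral_finsetSum]
  · refine sum_congr rfl fun i _ ↦ ?_
    rw [← intervalIntegral.integral_const_mul]
    exact intervalIntegral.integral_congr fun x _ ↦ by ring
  · intro i _
    exact ((continuous_const.mul (hgr i)).mul
      (continuous_cos.comp ((continuous_const.mul continuous_id).div_const _))).intervalIntegrable _ _

/-- PROVED: the Fejér coefficient is a fixed weight times the cosine moment. [folklore] -/
theorem fejerCoeff_eq_weight_mul (a : ℝ) (gr : ℝ → ℝ) (M n : ℕ) :
    fejerCoeff a gr M n = (∑ k ∈ Finset.range (M + 1), ∑ l ∈ Finset.range (M + 1),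
      if n = Nat.dist k l then 1 / (2 * a * (M + 1)) * xiScale a n else 0) * cosMoment a gr n := by
  simp only [fejerCoeff, Finset.sum_mul]
  exact sum_congr rfl fun k _ ↦ sum_congr rfl fun l _ ↦ by split_ifs <;> ring

/-- **PROVED — the Fejér coefficient vector is LINEAR in the function.** [folklore] -/
theorem fejerVec_sum_mul {n : ℕ} (a : ℝ) (c : Fin n → ℝ) (gr : Fin n → ℝ → ℝ) (hgr : ∀ i, Continuous (gr i))
    (M : ℕ) : fejerVec a (fun x ↦ ∑ i, c i * gr i x) M = ∑ i, c i • fejerVec a (gr i) M := by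
  funext m
  simp only [fejerVec, fejerCoeff_eq_weight_mul, cosMoment_sum_mul a c gr hgr, Finset.sum_apply, Pi.smul_apply,
    smul_eq_mul, Finset.mul_sum]
  exact sum_congr rfl fun i _ ↦ by ring

/-- PROVED: Connes profiles are linear in the coefficient vector. [folklore] -/
theorem profile_sum_smul {N n : ℕ} (L : ℝ) (c : Fin n → ℝ) (v : Fin n → Fin (N + 1) → ℝ) (x : ℝ) :
    profile L (∑ i, c i • v i) x = ∑ i, c i * profile L (v i) x := by
  simp only [profile, Finset.sum_apply, Pi.smul_apply, smul_eq_mul, Finset.sum_mul, Finset.mul_sum]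
  exact Finset.sum_comm.trans (sum_congr rfl fun i _ ↦ sum_congr rfl fun m _ ↦ by ring)

/-- **PROVED — cut-off profiles are linear in the coefficient vector** (as complex window functions). [folklore] -/
theorem cutoffProfile_sum_smul (win : Window) {n : ℕ} (c : Fin n → ℝ) (v : Fin n → Fin (win.N + 1) → ℝ) (t : ℝ) :
    cutoffProfile win (∑ i, c i • v i) t = ∑ i, (c i : ℂ) * cutoffProfile win (v i) t := by
  by_cases ht : t ∈ Icc (-win.a) win.a
  · simp only [cutoffProfile_apply, indicator_of_mem ht, profile_sum_smul, Complex.ofReal_sum, Complex.ofReal_mul]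
  · simp only [cutoffProfile_eq_zero_of_not_mem _ _ ht, mul_zero, Finset.sum_const_zero]

/-- the level-`M` FEJÉR–GALERKIN VECTOR of a test `g` at half-length `a`: the Connes coefficients of the `M`-th
Fejér mean of the even `2a`-periodisation of `re g` (the window vector used by GAL-1). [folklore] -/
def fejerGalerkinVec (a : ℝ) (g : ℝ → ℂ) (M : ℕ) : Fin (M + 1) → ℝ := fejerVec a (fun x ↦ (g x).re) M

/-- **PROVED — the Fejér–Galerkin vector is LINEAR over real combinations of tests.** [folklore] -/
theorem fejerGalerkinVec_sum {n : ℕ} (a : ℝ) (c : Fin n → ℝ) (g : Fin n → ℝ → ℂ) (hg : ∀ i, Continuous (g i))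
    (M : ℕ) : fejerGalerkinVec a (fun t ↦ ∑ i, (c i : ℂ) * g i t) M = ∑ i, c i • fejerGalerkinVec a (g i) M := by
  have h : (fun x : ℝ ↦ (∑ i, (c i : ℂ) * g i x).re) = fun x ↦ ∑ i, c i * (g i x).re := by
    funext x; simp [Complex.re_sum]
  simp only [fejerGalerkinVec, h]
  exact fejerVec_sum_mul a c _ (fun i ↦ Complex.continuous_re.comp (hg i)) M

/-! ## §3 One test: the explicit approximants are uniformly close EVENTUALLY IN `M`, with one Lipschitz constant -/

/-- **PROVED — quantitative GAL-1 approximation along the WHOLE Fejér ladder**: for a smooth even real test `g` on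
`[-a, a]` there is `K ≥ 0` with `θ_M − g` `K`-Lipschitz on the window for EVERY level `M`
(`θ_M = cutoffProfile (a, M) (fejerGalerkinVec a g M)`), and for every `ε > 0` the bound `‖θ_M − g‖_∞ ≤ ε` holds
for ALL sufficiently large `M` (not just for one).  Refines `exists_cutoffProfile_near`. [folklore] -/
theorem fejerGalerkin_approx {a : ℝ} (ha : 0 < a) {g : ℝ → ℂ} (hg : IsWeilTest g) (hs : tsupport g ⊆ Icc (-a) a)
    (hev : ∀ t, g (-t) = g t) (hre : ∀ t, (g t).im = 0) :
    ∃ K : ℝ, 0 ≤ K ∧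
      (∀ M : ℕ, ∀ x ∈ Icc (-a) a, ∀ y ∈ Icc (-a) a,
        ‖(cutoffProfile ⟨a, M, ha⟩ (fejerGalerkinVec a g M) x - g x) -
            (cutoffProfile ⟨a, M, ha⟩ (fejerGalerkinVec a g M) y - g y)‖ ≤ K * |x - y|) ∧
      ∀ ε : ℝ, 0 < ε → ∃ M₀ : ℕ, ∀ M : ℕ, M₀ ≤ M →
        ∀ x, ‖cutoffProfile ⟨a, M, ha⟩ (fejerGalerkinVec a g M) x - g x‖ ≤ ε := by
  have hπ := Real.pi_pos
  set gr : ℝ → ℝ := fun x ↦ (g x).re with hgr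
  have hfg : ∀ M, fejerGalerkinVec a g M = fejerVec a gr M := fun M ↦ by rw [hgr]; rfl
  have hgeq : ∀ x, g x = (gr x : ℂ) := fun x ↦ Complex.ext (by simp [hgr]) (by simp [hgr, hre x])
  have hgrc : Continuous gr := Complex.continuous_re.comp hg.1.continuous
  have hgrev : ∀ s, gr (-s) = gr s := fun s ↦ by simp only [hgr, hev]
  obtain ⟨K₀, hK₀⟩ := ContDiff.lipschitzWith_of_hasCompactSupport hg.2 hg.1 (by simp)
  obtain ⟨S, hS⟩ := hg.2.exists_bound_of_continuous hg.1.continuous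
  have hK : ∀ x y, |gr x - gr y| ≤ K₀ * |x - y| := by
    intro x y
    calc |gr x - gr y| = |(g x - g y).re| := by simp [hgr]
      _ ≤ ‖g x - g y‖ := Complex.abs_re_le_norm _
      _ = dist (g x) (g y) := (dist_eq_norm _ _).symm
      _ ≤ K₀ * dist x y := hK₀.dist_le_mul x y
      _ = K₀ * |x - y| := by rw [Real.dist_eq]
  have hSr : ∀ x, |gr x| ≤ S := fun x ↦ (Complex.abs_re_le_norm _).trans (hS x)
  have hK0 : (0 : ℝ) ≤ K₀ := K₀.2
  set G := periodize a gr with hGdef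
  have hGK : ∀ x y, |G x - G y| ≤ K₀ * |x - y| := abs_periodize_sub_le hK0 hK
  have hGS : ∀ x, |G x| ≤ S := fun x ↦ hSr _
  have hGc : Continuous G := continuous_of_abs_sub_le hGK
  have hGp : Function.Periodic G (2 * a) := periodize_periodic a gr
  have hGeq : ∀ s ∈ Icc (-a) a, G s = gr s := fun s hs ↦ periodize_eq ha hgrev hs
  have hS0 : 0 ≤ S := (norm_nonneg _).trans (hS 0)
  -- on the window the difference is the real number `σ_M G - G`
  have hwin : ∀ (M : ℕ), ∀ x ∈ Icc (-a) a,
      cutoffProfile ⟨a, M, ha⟩ (fejerGalerkinVec a g M) x - g x = ((fejerMean a G M x - G x : ℝ) : ℂ) := by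
    intro M x hx
    rw [cutoffProfile_apply, indicator_of_mem hx, hgeq x, ← Complex.ofReal_sub,
      show (⟨a, M, ha⟩ : Window).a = a from rfl, hfg M, ← fejerMean_eq_profile ha hGc hGp hGeq hgrev hgrc M x,
      ← hGeq x hx]
  refine ⟨2 * K₀, by positivity, fun M x hx y hy ↦ ?_, fun ε hε ↦ ?_⟩
  · rw [hwin M x hx, hwin M y hy, ← Complex.ofReal_sub, Complex.norm_real, Real.norm_eq_abs]
    calc |fejerMean a G M x - G x - (fejerMean a G M y - G y)|
        = |(fejerMean a G M x - fejerMean a G M y) - (G x - G y)| := by ring_nf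
      _ ≤ |fejerMean a G M x - fejerMean a G M y| + |G x - G y| := abs_sub _ _
      _ ≤ K₀ * |x - y| + K₀ * |x - y| :=
          add_le_add (abs_fejerMean_sub_fejerMean_le hGK a M x y) (hGK x y)
      _ = 2 * K₀ * |x - y| := by ring
  · -- choose `δ`, then `M₀`; every `M ≥ M₀` works
    set δ : ℝ := ε / (2 * (K₀ * (a / π) + 1)) with hδ
    have hKc : 0 ≤ K₀ * (a / π) := by positivity
    have hδ0 : 0 < δ := by positivity
    have hδ1 : K₀ * (a / π) * δ ≤ ε / 2 := by
      rw [hδ, show K₀ * (a / π) * (ε / (2 * (K₀ * (a / π) + 1))) =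
        ε / 2 * (K₀ * (a / π) / (K₀ * (a / π) + 1)) by field_simp]
      exact mul_le_of_le_one_right (by positivity) ((div_le_one (by positivity)).2 (by linarith))
    obtain ⟨M₀, hM₀⟩ := exists_nat_gt (2 * S * π ^ 2 / (δ ^ 2 * (ε / 2)))
    refine ⟨M₀, fun M hM x ↦ ?_⟩
    have hM' : 2 * S * π ^ 2 / (δ ^ 2 * (ε / 2)) < M := hM₀.trans_le (by exact_mod_cast hM)
    have hM1 : 2 * S * π ^ 2 / (δ ^ 2 * (M + 1)) ≤ ε / 2 := by
      rw [div_le_iff₀ (by positivity)]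
      have h1 : 2 * S * π ^ 2 / (δ ^ 2 * (ε / 2)) * (δ ^ 2 * (ε / 2)) = 2 * S * π ^ 2 := by
        field_simp
      nlinarith [hM', sq_nonneg δ, mul_pos (pow_pos hδ0 2) (half_pos hε)]
    by_cases hx : x ∈ Icc (-a) a
    · rw [hwin M x hx, Complex.norm_real, Real.norm_eq_abs]
      calc |fejerMean a G M x - G x| ≤ K₀ * (a / π) * δ + 2 * S * π ^ 2 / (δ ^ 2 * (M + 1)) :=
            abs_fejerMean_sub_le ha hK0 hGK hGS M hδ0 x
        _ ≤ ε / 2 + ε / 2 := add_le_add hδ1 hM1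
        _ = ε := by ring
    · rw [cutoffProfile_eq_zero_of_not_mem _ _ hx, image_eq_zero_of_notMem_tsupport (fun h ↦ hx (hs h)),
        sub_zero, norm_zero]
      exact hε.le

end Summit.RiemannHypothesis.RiemannHypothesis.Theorems.PfPersistence
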